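import Summits.AnomalousDissipation.AnomalousDissipation.Theorems.MomentParityQuarticGateCubicAssemblyQuartet
import Summits.AnomalousDissipation.AnomalousDissipation.Theorems.MomentParityQuarticGateFourierDictionaryPart3

/-!
# Cubic assembly for the axial Casimir stub (line `axis-sectors` of crux `MomentParity.QuarticGate`), II:
# the cubic coefficient tensor, shear twists and the `H_L`-average

For test families `vⱼ` and a real homogeneous cubic `P` (`Pℂ = map (algebraMap ℝ ℂ) P`,
`H i j l = coeff 0 (∂ᵢ∂ⱼ∂ₗ Pℂ)`), the complexified observable `F(c) = Pℂ((ℓ_{vⱼ}(c))ⱼ)` is the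
TRIPLE MODE SUM `F(c) = Σ_{k,p,q ∈ S*} Σ_{abc} Γ̃ k p q a b c · c_k,a c_p,b c_q,c` with
`Γ̃ k p q a b c = (1/6) Σ H i j l vᵢ(-k)_a vⱼ(-p)_b vₗ(-q)_c` (`observableC_eq_triple_sum`); under a
twist `c ↦ (χ k • c k)_k` each term picks up `χ k χ p χ q` (`observableC_twist_eq_triple_sum`); for the
shear twists `χ = e_·(-a)`, `a` on the grid `H_L`, the character sums of the dictionary (part 3) and
Nyquist (`|θ₀|, |θ₂| ≤ 3N < L`) leave exactly the AXIAL sectors: if `F` is `H_L`-twist invariant then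
`F(c) = Σ_{k,p,q ∈ S*, (k+p+q)₀ = (k+p+q)₂ = 0} Σ_{abc} Γ̃ · c c c` (`observableC_eq_axial_sum`).
-/

namespace Summit.AnomalousDissipation.AnomalousDissipation.Theorems.MomentParityQuarticGate

open MeasureTheory Filter
open scoped InnerProductSpace RealInnerProductSpace ComplexConjugate ENNReal
open Literature.Analysis.FunctionSpaces Literature.Analysis.FluidPDE
open Summit.AnomalousDissipation.AnomalousDissipation.Theses.MomentParity
open Summit.AnomalousDissipation.AnomalousDissipation.Theorems.QuarticGate.Negative

-- `Summit.<Summit>.<Problem>` is the tree's mandated summit-side namespace (CONVENTIONS §2); for this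
-- single-conjunct summit the two coincide, so the duplicate is deliberate.
set_option linter.dupNamespace false

noncomputable section

section Triple

variable {N m : ℕ}

/-- **Reindexing** (finite-set version): the contraction of a tensor against three finite sums
factors through the inner sums. [folklore] -/
theorem sum_tensor_contract_finset {κ : Type*} (T : Finset κ) (H : Fin m → Fin m → Fin m → ℂ)
    (A B C : Fin m → κ → ℂ) (t u s : κ → ℂ) :
    ∑ x ∈ T, ∑ y ∈ T, ∑ z ∈ T, (∑ i, ∑ j, ∑ l, H i j l * A i x * B j y * C l z) * t x * u y * s z =
      ∑ i, ∑ j, ∑ l, H i j l * (∑ x ∈ T, A i x * t x) * (∑ y ∈ T, B j y * u y) * (∑ z ∈ T, C l z * s z) := by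
  classical
  calc ∑ x ∈ T, ∑ y ∈ T, ∑ z ∈ T, (∑ i, ∑ j, ∑ l, H i j l * A i x * B j y * C l z) * t x * u y * s z
      = ∑ x ∈ T, ∑ y ∈ T, ∑ z ∈ T, ∑ i, ∑ j, ∑ l, H i j l * A i x * B j y * C l z * t x * u y * s z := by
        simp only [Finset.sum_mul]
    _ = ∑ X ∈ T ×ˢ T ×ˢ T, ∑ Y : Fin m × Fin m × Fin m,
          H Y.1 Y.2.1 Y.2.2 * A Y.1 X.1 * B Y.2.1 X.2.1 * C Y.2.2 X.2.2 * t X.1 * u X.2.1 * s X.2.2 := by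
        rw [Finset.sum_product, Finset.sum_congr rfl fun x _ => Finset.sum_product _ _ _]
        simp only [Fintype.sum_prod_type]
    _ = ∑ Y : Fin m × Fin m × Fin m, ∑ X ∈ T ×ˢ T ×ˢ T,
          H Y.1 Y.2.1 Y.2.2 * A Y.1 X.1 * B Y.2.1 X.2.1 * C Y.2.2 X.2.2 * t X.1 * u X.2.1 * s X.2.2 :=
        Finset.sum_comm
    _ = ∑ i, ∑ j, ∑ l, ∑ x ∈ T, ∑ y ∈ T, ∑ z ∈ T, H i j l * A i x * B j y * C l z * t x * u y * s z := by
        simp only [Fintype.sum_prod_type]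
        refine Finset.sum_congr rfl fun i _ => Finset.sum_congr rfl fun j _ => Finset.sum_congr rfl fun l _ => ?_
        rw [Finset.sum_product, Finset.sum_congr rfl fun x _ => Finset.sum_product _ _ _]
    _ = ∑ i, ∑ j, ∑ l, H i j l * (∑ x ∈ T, A i x * t x) * (∑ y ∈ T, B j y * u y) * (∑ z ∈ T, C l z * s z) := by
        refine Finset.sum_congr rfl fun i _ => Finset.sum_congr rfl fun j _ => Finset.sum_congr rfl fun l _ => ?_
        symm
        rw [Finset.mul_sum (f := fun x => A i x * t x), Finset.sum_mul, Finset.sum_mul]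
        refine Finset.sum_congr rfl fun x _ => ?_
        rw [Finset.mul_sum (f := fun y => B j y * u y), Finset.sum_mul]
        refine Finset.sum_congr rfl fun y _ => ?_
        rw [Finset.mul_sum (f := fun z => C l z * s z)]
        exact Finset.sum_congr rfl fun z _ => by ring


/-- **The complexified observable of a homogeneous cubic is the triple mode sum**
`F(c) = Σ_{k,p,q ∈ S*} Σ_{abc} Γ̃ k p q a b c · c_k,a c_p,b c_q,c`,
`Γ̃ k p q a b c = (1/6) Σ H i j l vᵢ(-k)_a vⱼ(-p)_b vₗ(-q)_c` (Euler/Taylor, `eval_eq_sum_of_isHomogeneous_three`).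
[folklore] -/
theorem observableC_eq_triple_sum (v : Fin m → (Fin 3 → ℤ) → EuclideanSpace ℂ (Fin 3)) {P : MvPolynomial (Fin m) ℝ}
    (hP : P.IsHomogeneous 3) (c : (Fin 3 → ℤ) → EuclideanSpace ℂ (Fin 3)) :
    MvPolynomial.eval (fun j => ∑ k ∈ (Torus.freqBall N).erase 0, ∑ a, c k a * v j (-k) a)
        (MvPolynomial.map (algebraMap ℝ ℂ) P) =
      ∑ k ∈ (Torus.freqBall N).erase 0, ∑ p ∈ (Torus.freqBall N).erase 0, ∑ q ∈ (Torus.freqBall N).erase 0,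
        ∑ a, ∑ b, ∑ d,
          ((1 / 6 : ℂ) * ∑ i, ∑ j, ∑ l,
            MvPolynomial.coeff 0 (MvPolynomial.pderiv i (MvPolynomial.pderiv j (MvPolynomial.pderiv l
              (MvPolynomial.map (algebraMap ℝ ℂ) P)))) * v i (-k) a * v j (-p) b * v l (-q) d) *
          c k a * c p b * c q d := by
  classical
  rw [eval_eq_sum_of_isHomogeneous_three (hP.map (algebraMap ℝ ℂ))]
  set H : Fin m → Fin m → Fin m → ℂ := fun i j l => MvPolynomial.coeff 0 (MvPolynomial.pderiv i
    (MvPolynomial.pderiv j (MvPolynomial.pderiv l (MvPolynomial.map (algebraMap ℝ ℂ) P)))) with hHdef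
  have hH' : ∀ i j l, MvPolynomial.coeff 0 (MvPolynomial.pderiv i (MvPolynomial.pderiv j (MvPolynomial.pderiv l
      (MvPolynomial.map (algebraMap ℝ ℂ) P)))) = H i j l := fun _ _ _ => rfl
  simp only [hH']
  -- the inner sums, contracted over the vector index first
  have hℓ : ∀ i, ∑ k ∈ (Torus.freqBall N).erase 0, ∑ a, c k a * v i (-k) a =
      ∑ k ∈ (Torus.freqBall N).erase 0, (∑ a, v i (-k) a * c k a) * (1 : ℂ) := fun i => by
    refine Finset.sum_congr rfl fun k _ => ?_
    rw [mul_one]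
    exact Finset.sum_congr rfl fun a _ => mul_comm _ _
  simp only [hℓ]
  rw [← sum_tensor_contract_finset ((Torus.freqBall N).erase 0) H
    (fun i k => ∑ a, v i (-k) a * c k a) (fun j k => ∑ a, v j (-k) a * c k a) (fun l k => ∑ a, v l (-k) a * c k a)
    (fun _ => 1) (fun _ => 1) (fun _ => 1)]
  simp only [mul_one]
  rw [Finset.mul_sum]
  refine Finset.sum_congr rfl fun k _ => ?_
  rw [Finset.mul_sum]
  refine Finset.sum_congr rfl fun p _ => ?_
  rw [Finset.mul_sum]
  refine Finset.sum_congr rfl fun q _ => ?_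
  rw [← sum_tensor_contract H (fun i a => v i (-k) a) (fun j b => v j (-p) b) (fun l d => v l (-q) d)
    (fun a => c k a) (fun b => c p b) (fun d => c q d), Finset.mul_sum]
  refine Finset.sum_congr rfl fun a _ => ?_
  rw [Finset.mul_sum]
  refine Finset.sum_congr rfl fun b _ => ?_
  rw [Finset.mul_sum]
  refine Finset.sum_congr rfl fun d _ => ?_
  ring

/-- **The triple mode sum of a twisted family**: under `c ↦ (χ k • c k)_k` the `(k, p, q)` term picks up
the factor `χ k · χ p · χ q`. [folklore] -/
theorem observableC_twist_eq_triple_sum (v : Fin m → (Fin 3 → ℤ) → EuclideanSpace ℂ (Fin 3))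
    {P : MvPolynomial (Fin m) ℝ} (hP : P.IsHomogeneous 3) (c : (Fin 3 → ℤ) → EuclideanSpace ℂ (Fin 3))
    (χ : (Fin 3 → ℤ) → ℂ) :
    MvPolynomial.eval (fun j => ∑ k ∈ (Torus.freqBall N).erase 0, ∑ a, (χ k • c k) a * v j (-k) a)
        (MvPolynomial.map (algebraMap ℝ ℂ) P) =
      ∑ k ∈ (Torus.freqBall N).erase 0, ∑ p ∈ (Torus.freqBall N).erase 0, ∑ q ∈ (Torus.freqBall N).erase 0,
        χ k * χ p * χ q * ∑ a, ∑ b, ∑ d,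
          ((1 / 6 : ℂ) * ∑ i, ∑ j, ∑ l,
            MvPolynomial.coeff 0 (MvPolynomial.pderiv i (MvPolynomial.pderiv j (MvPolynomial.pderiv l
              (MvPolynomial.map (algebraMap ℝ ℂ) P)))) * v i (-k) a * v j (-p) b * v l (-q) d) *
          c k a * c p b * c q d := by
  rw [observableC_eq_triple_sum v hP (fun k => χ k • c k)]
  refine Finset.sum_congr rfl fun k _ => Finset.sum_congr rfl fun p _ => Finset.sum_congr rfl fun q _ => ?_
  rw [Finset.mul_sum]
  refine Finset.sum_congr rfl fun a _ => ?_
  rw [Finset.mul_sum]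
  refine Finset.sum_congr rfl fun b _ => ?_
  rw [Finset.mul_sum]
  refine Finset.sum_congr rfl fun d _ => ?_
  simp only [PiLp.smul_apply, smul_eq_mul]
  ring

end Triple

/-! ## Shear twists on the grid `H_L` and the axial sectors -/

section Axial

variable {N m : ℕ}

/-- `e_n(-x) = e_{-n}(x)`. [folklore] -/
theorem mFourier_apply_neg_pt (n : Fin 3 → ℤ) (x : UnitAddTorus (Fin 3)) :
    (UnitAddTorus.mFourier n (-x) : ℂ) = UnitAddTorus.mFourier (-n) x := by
  simp only [UnitAddTorus.mFourier, ContinuousMap.coe_mk, Pi.neg_apply]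
  refine Finset.prod_congr rfl fun i _ => ?_
  rw [fourier_apply, fourier_apply, smul_neg, neg_smul]

/-- `e_k(x) e_p(x) e_q(x) = e_{k+p+q}(x)`. [folklore] -/
theorem mFourier_mul_mul (k p q : Fin 3 → ℤ) (x : UnitAddTorus (Fin 3)) :
    (UnitAddTorus.mFourier k x : ℂ) * UnitAddTorus.mFourier p x * UnitAddTorus.mFourier q x =
      UnitAddTorus.mFourier (k + p + q) x := by
  rw [UnitAddTorus.mFourier_add, UnitAddTorus.mFourier_add]

/-- **Character sums of the inverse grid points below the Nyquist frequency**: for `|θ₀|, |θ₂| < L`,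
`Σ_{a ∈ H_L} e_θ(-a) = L²` if `θ₀ = θ₂ = 0`, else `0` (dictionary, part 3). [folklore] -/
theorem sum_grid_char_neg {L : ℕ} (hL : 0 < L) (θ : Fin 3 → ℤ) (h0 : |θ 0| < L) (h2 : |θ 2| < L) :
    ∑ j : Fin L × Fin L, (UnitAddTorus.mFourier θ
        (-(fun i => ((((![(j.1 : ℕ), 0, (j.2 : ℕ)] : Fin 3 → ℕ) i : ℝ) / L : ℝ) : UnitAddCircle))) : ℂ) =
      if θ 0 = 0 ∧ θ 2 = 0 then ((L : ℂ)) ^ 2 else 0 := by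
  simp_rw [mFourier_apply_neg_pt]
  rw [sum_mFourier_shearGrid_of_abs_lt hL (-θ) (by simpa using h0) (by simpa using h2)]
  simp only [Pi.neg_apply, neg_eq_zero]

/-- Coordinates of a sum of three ball frequencies are below `3N` in absolute value. [folklore] -/
theorem abs_apply_add_add_lt {L : ℕ} (hNL : 3 * N < L) {k p q : Fin 3 → ℤ} (hk : k ∈ (Torus.freqBall N).erase 0)
    (hp : p ∈ (Torus.freqBall N).erase 0) (hq : q ∈ (Torus.freqBall N).erase 0) (i : Fin 3) :
    |(k + p + q) i| < (L : ℤ) := by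
  have h1 := abs_apply_le_of_mem_freqBall (Finset.mem_of_mem_erase hk) i
  have h2 := abs_apply_le_of_mem_freqBall (Finset.mem_of_mem_erase hp) i
  have h3 := abs_apply_le_of_mem_freqBall (Finset.mem_of_mem_erase hq) i
  have hL : ((3 * N : ℕ) : ℤ) < (L : ℤ) := by exact_mod_cast hNL
  have h4 : |(k + p + q) i| ≤ |k i| + |p i| + |q i| := by
    simp only [Pi.add_apply]
    exact abs_add_three (k i) (p i) (q i)
  push_cast at hL
  linarith

/-- **The `H_L`-average: only axial sectors survive.** If the complexified observable of a homogeneous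
cubic is invariant under all shear twists `c ↦ (e_k(-a) • c k)_k`, `a ∈ H_L` (the grid), and `3N < L`,
then `F(c) = Σ_{k,p,q ∈ S*} [ (k+p+q)₀ = (k+p+q)₂ = 0 ] Σ_{abc} Γ̃ · c c c` — the triple mode sum
restricted to the AXIAL momentum sectors (average the twisted triple sums over the grid; the character
sums detect `θ₀ ≡ θ₂ ≡ 0 (mod L)`, and `|θ₀|, |θ₂| ≤ 3N < L`). [folklore] -/
theorem observableC_eq_axial_sum {L : ℕ} (hL : 0 < L) (hNL : 3 * N < L)
    (v : Fin m → (Fin 3 → ℤ) → EuclideanSpace ℂ (Fin 3)) {P : MvPolynomial (Fin m) ℝ} (hP : P.IsHomogeneous 3)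
    (c : (Fin 3 → ℤ) → EuclideanSpace ℂ (Fin 3))
    (hinv : ∀ j : Fin L × Fin L,
      MvPolynomial.eval (fun j' => ∑ k ∈ (Torus.freqBall N).erase 0, ∑ a, ((UnitAddTorus.mFourier k
          (-(fun i => ((((![(j.1 : ℕ), 0, (j.2 : ℕ)] : Fin 3 → ℕ) i : ℝ) / L : ℝ) : UnitAddCircle))) : ℂ) • c k) a *
          v j' (-k) a) (MvPolynomial.map (algebraMap ℝ ℂ) P) =
        MvPolynomial.eval (fun j' => ∑ k ∈ (Torus.freqBall N).erase 0, ∑ a, c k a * v j' (-k) a)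
          (MvPolynomial.map (algebraMap ℝ ℂ) P)) :
    MvPolynomial.eval (fun j => ∑ k ∈ (Torus.freqBall N).erase 0, ∑ a, c k a * v j (-k) a)
        (MvPolynomial.map (algebraMap ℝ ℂ) P) =
      ∑ k ∈ (Torus.freqBall N).erase 0, ∑ p ∈ (Torus.freqBall N).erase 0, ∑ q ∈ (Torus.freqBall N).erase 0,
        (if (k + p + q) 0 = 0 ∧ (k + p + q) 2 = 0 then (1 : ℂ) else 0) * ∑ a, ∑ b, ∑ d,
          ((1 / 6 : ℂ) * ∑ i, ∑ j, ∑ l,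
            MvPolynomial.coeff 0 (MvPolynomial.pderiv i (MvPolynomial.pderiv j (MvPolynomial.pderiv l
              (MvPolynomial.map (algebraMap ℝ ℂ) P)))) * v i (-k) a * v j (-p) b * v l (-q) d) *
          c k a * c p b * c q d := by
  classical
  -- abbreviate the sector summand
  set Inner : (Fin 3 → ℤ) → (Fin 3 → ℤ) → (Fin 3 → ℤ) → ℂ := fun k p q => ∑ a, ∑ b, ∑ d,
    ((1 / 6 : ℂ) * ∑ i, ∑ j, ∑ l,
      MvPolynomial.coeff 0 (MvPolynomial.pderiv i (MvPolynomial.pderiv j (MvPolynomial.pderiv l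
        (MvPolynomial.map (algebraMap ℝ ℂ) P)))) * v i (-k) a * v j (-p) b * v l (-q) d) *
    c k a * c p b * c q d with hIdef
  have hI' : ∀ k p q, ∑ a, ∑ b, ∑ d,
      ((1 / 6 : ℂ) * ∑ i, ∑ j, ∑ l,
        MvPolynomial.coeff 0 (MvPolynomial.pderiv i (MvPolynomial.pderiv j (MvPolynomial.pderiv l
          (MvPolynomial.map (algebraMap ℝ ℂ) P)))) * v i (-k) a * v j (-p) b * v l (-q) d) *
      c k a * c p b * c q d = Inner k p q := fun _ _ _ => rfl
  simp only [hI']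
  have hLc : ((L : ℂ)) ^ 2 ≠ 0 := pow_ne_zero 2 (Nat.cast_ne_zero.2 hL.ne')
  -- the grid sum of the twisted observables is `L² F(c)` by invariance …
  have hsum : ∑ j : Fin L × Fin L,
      MvPolynomial.eval (fun j' => ∑ k ∈ (Torus.freqBall N).erase 0, ∑ a, ((UnitAddTorus.mFourier k
          (-(fun i => ((((![(j.1 : ℕ), 0, (j.2 : ℕ)] : Fin 3 → ℕ) i : ℝ) / L : ℝ) : UnitAddCircle))) : ℂ) • c k) a *
          v j' (-k) a) (MvPolynomial.map (algebraMap ℝ ℂ) P) =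
      ((L : ℂ)) ^ 2 * MvPolynomial.eval (fun j => ∑ k ∈ (Torus.freqBall N).erase 0, ∑ a, c k a * v j (-k) a)
        (MvPolynomial.map (algebraMap ℝ ℂ) P) := by
    rw [Finset.sum_congr rfl fun j _ => hinv j, Finset.sum_const, Finset.card_univ, Fintype.card_prod,
      Fintype.card_fin, nsmul_eq_mul]
    push_cast
    ring
  -- … and, term by term, the triple sum weighted by character sums
  simp_rw [observableC_twist_eq_triple_sum v hP c, hI', mFourier_mul_mul] at hsum
  rw [Finset.sum_comm] at hsum
  have hsum' : ∑ k ∈ (Torus.freqBall N).erase 0, ∑ p ∈ (Torus.freqBall N).erase 0, ∑ q ∈ (Torus.freqBall N).erase 0,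
      (if (k + p + q) 0 = 0 ∧ (k + p + q) 2 = 0 then ((L : ℂ)) ^ 2 else 0) * Inner k p q =
      ((L : ℂ)) ^ 2 * MvPolynomial.eval (fun j => ∑ k ∈ (Torus.freqBall N).erase 0, ∑ a, c k a * v j (-k) a)
        (MvPolynomial.map (algebraMap ℝ ℂ) P) := by
    rw [← hsum]
    refine Finset.sum_congr rfl fun k hk => ?_
    conv_rhs => rw [Finset.sum_comm]
    refine Finset.sum_congr rfl fun p hp => ?_
    conv_rhs => rw [Finset.sum_comm]
    refine Finset.sum_congr rfl fun q hq => ?_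
    rw [← Finset.sum_mul, sum_grid_char_neg hL (k + p + q) (abs_apply_add_add_lt hNL hk hp hq 0)
      (abs_apply_add_add_lt hNL hk hp hq 2)]
  -- divide by `L²`
  refine mul_left_cancel₀ hLc ?_
  rw [← hsum', Finset.mul_sum]
  refine Finset.sum_congr rfl fun k _ => ?_
  rw [Finset.mul_sum]
  refine Finset.sum_congr rfl fun p _ => ?_
  rw [Finset.mul_sum]
  refine Finset.sum_congr rfl fun q _ => ?_
  split_ifs <;> ring

end Axial


end

/-! ## Registered sub-goal (summary) -/

/-- **Registered sub-goal `cubicAssembly_sum_grid_char_neg` (compact anchor of this file, whose main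
results are `observableC_eq_triple_sum` and `observableC_eq_axial_sum`)**: below the Nyquist frequency the
character sum over the inverse grid points of `H_L` detects the axial frequencies. [folklore] -/
theorem cubicAssembly_sum_grid_char_neg : ∀ (L : ℕ) (θ : Fin 3 → ℤ), 0 < L → |θ 0| < L → |θ 2| < L → ∑ j : Fin L × Fin L, (UnitAddTorus.mFourier θ (-(fun i => ((((![(j.1 : ℕ), 0, (j.2 : ℕ)] : Fin 3 → ℕ) i : ℝ) / L : ℝ) : UnitAddCircle))) : ℂ) = if θ 0 = 0 ∧ θ 2 = 0 then ((L : ℂ)) ^ 2 else 0 :=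
  fun _ θ hL h0 h2 => sum_grid_char_neg hL θ h0 h2

end Summit.AnomalousDissipation.AnomalousDissipation.Theorems.MomentParityQuarticGate
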